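import Mathlib

/-!
# Crux `BinomialElusive.BinomialCandidate` (stmt-ValiantsHypothesis-7392), line `registered` —
# helper `binaryQuadratic_squares` (piece A of `stub_nondegenerateCorankTwo`, skeleton v6)

Pure linear algebra over `ℂ`.  Three binary quadratic forms
`c_a(X, Y) = c a 0 · X² + c a 1 · X Y + c a 2 · Y²` (`a : Fin 3`) with no common nontrivial zero
admit an invertible `3 × 3` recombination `Λ` of the forms and an invertible `2 × 2` change of
variables `(X, Y) = σ (x, y)` after which form `0` is `y²` and form `1` is `x²`: a base-point-free
net of binary quadratics contains two independent squares.

Proof.  Forms are coefficient triples `f : Fin 3 → ℂ` with evaluation `EV[f, X, Y]`, the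
hypothesis on a system `c` is `BPF[c]` and the conclusion `GOOD[c]` (local notations only, no
definitions).  Both are transported along three elementary moves — permuting the forms
(`good_of_perm`), an invertible recombination of the forms (`good_of_comb`), an invertible linear
substitution (`good_of_subst`) — and the proof is a chain of reductions to the normal form
`c 0 = Y²`, `c 1 = X²` (`good_base`, identity matrices).
* Every binary quadratic form has a nontrivial zero over `ℂ` (`exists_zero`, quadratic formula with
  `IsAlgClosed.exists_eq_mul_self`); a form of zero discriminant is a square (`exists_sq`).
* By the hypothesis at `(1, 0)` some form, after a permutation `c 0`, has a nonzero
  `X²`-coefficient; a nontrivial zero `(X₀, Y₀)` of `c 0` is not a common zero: after a permutation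
  `c 1 (X₀, Y₀) ≠ 0`.  The discriminant of the pencil `s c 0 + t c 1` is a binary quadratic form in
  `(s, t)`, so it has a nontrivial zero `(s₀, t₀)`; the member `f = s₀ c 0 + t₀ c 1` is nonzero
  (evaluate at `(X₀, Y₀)`, then read the `X²`-coefficient) of zero discriminant, so `f = ℓ²` with
  `ℓ = u X + v Y ≠ 0` (`good_x01`).  Adapted coordinates (`exists_adapted`) make `ℓ` the new `Y`:
  `Y² = Σ_b s_b c_b`; after a permutation `s 0 ≠ 0`, and the recombination
  "form `0 ← Σ_b s_b c_b`" makes `c 0 = Y²` (`good_of_ysq`, `good_of_ysq0`).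
* By the hypothesis at `(1, 0)` again some `c b₀`, `b₀ ≠ 0`, after a permutation `c 1`, is
  `α X² + β X Y + γ Y²` with `α ≠ 0`.  The shear `X = x + m y`, `Y = y`, `m = -β / 2α`, turns it
  into `α x² + κ y²`, and "form `1 ← (form 1 - κ · form 0) / α`" gives the normal form
  (`good_at0`, `good_at1`).
All identities are polynomial identities in `(x, y)` checked by `ring`; all inverse matrices are
explicit.  Mathlib only.
-/

-- layout Summits/ValiantsHypothesis/ValiantsHypothesis forces the duplicated namespace component
set_option linter.dupNamespace false

namespace Summit.ValiantsHypothesis.ValiantsHypothesis.Theorems.BinomialCandidateStubs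

namespace CorankTwoSquares

/-- Evaluation of the binary quadratic form with coefficient triple `f` at `(X, Y)`. -/
local notation3 (prettyPrint := false) "EV[" f ", " X ", " Y "]" =>
  f 0 * X ^ 2 + f 1 * X * Y + f 2 * Y ^ 2

/-- Base-point-freeness: the three forms `c a` have no common nontrivial zero. -/
local notation3 (prettyPrint := false) "BPF[" c "]" =>
  ∀ x y : ℂ, (∀ a, EV[c a, x, y] = 0) → x = 0 ∧ y = 0

/-- The conclusion of `binaryQuadratic_squares` for the system of forms `c`. -/
local notation3 (prettyPrint := false) "GOOD[" c "]" =>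
  ∃ (Λ Λ' : Matrix (Fin 3) (Fin 3) ℂ) (σ σ' : Matrix (Fin 2) (Fin 2) ℂ),
    Λ * Λ' = 1 ∧ Λ' * Λ = 1 ∧ σ * σ' = 1 ∧ σ' * σ = 1 ∧
    (∀ x y : ℂ, ∑ b, Λ 0 b * EV[c b, σ 0 0 * x + σ 0 1 * y, σ 1 0 * x + σ 1 1 * y] = y ^ 2) ∧
    (∀ x y : ℂ, ∑ b, Λ 1 b * EV[c b, σ 0 0 * x + σ 0 1 * y, σ 1 0 * x + σ 1 1 * y] = x ^ 2)

/-- Composing two substitutions is the substitution by the product matrix. -/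
theorem mul_subst (τ σ : Matrix (Fin 2) (Fin 2) ℂ) (x y : ℂ) (i : Fin 2) :
    τ i 0 * (σ 0 0 * x + σ 0 1 * y) + τ i 1 * (σ 1 0 * x + σ 1 1 * y) =
      (τ * σ) i 0 * x + (τ * σ) i 1 * y := by
  simp only [Matrix.mul_apply, Fin.sum_univ_two]
  ring

/-! ### Binary quadratic forms over `ℂ` -/

/-- Every binary quadratic form has a nontrivial zero over `ℂ`. -/
theorem exists_zero (p q r : ℂ) :
    ∃ X Y : ℂ, (X ≠ 0 ∨ Y ≠ 0) ∧ p * X ^ 2 + q * X * Y + r * Y ^ 2 = 0 := by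
  by_cases hp : p = 0
  · exact ⟨1, 0, Or.inl one_ne_zero, by simp [hp]⟩
  · obtain ⟨s, hs⟩ := IsAlgClosed.exists_eq_mul_self (q ^ 2 - 4 * p * r)
    refine ⟨(s - q) / (2 * p), 1, Or.inr one_ne_zero, ?_⟩
    have key : p * ((s - q) / (2 * p)) ^ 2 + q * ((s - q) / (2 * p)) * 1 + r * 1 ^ 2 =
        (s * s - (q ^ 2 - 4 * p * r)) / (4 * p) := by
      field_simp
      ring
    rw [key, ← hs, sub_self, zero_div]

/-- A binary quadratic form of zero discriminant is the square of a linear form. -/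
theorem exists_sq (p q r : ℂ) (h : q ^ 2 = 4 * p * r) :
    ∃ u v : ℂ, p = u ^ 2 ∧ q = 2 * u * v ∧ r = v ^ 2 := by
  by_cases hp : p = 0
  · have hq : q = 0 := by simpa [hp] using h
    obtain ⟨s, hs⟩ := IsAlgClosed.exists_eq_mul_self r
    exact ⟨0, s, by simp [hp], by simp [hq], by rw [hs]; ring⟩
  · obtain ⟨s, hs⟩ := IsAlgClosed.exists_eq_mul_self p
    have hs0 : s ≠ 0 := by rintro rfl; exact hp (by simpa using hs)
    refine ⟨s, q / (2 * s), by rw [hs]; ring, ?_, ?_⟩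
    · field_simp
    · have key : (q / (2 * s)) ^ 2 = (q ^ 2 - 4 * p * r) / (4 * p) + r := by
        rw [hs]
        field_simp
        ring
      rw [key, h, sub_self, zero_div, zero_add]

/-- Adapted coordinates: an invertible substitution making the nonzero linear form `u X + v Y`
the new second coordinate `y`. -/
theorem exists_adapted (u v : ℂ) (h : u ≠ 0 ∨ v ≠ 0) :
    ∃ τ τ' : Matrix (Fin 2) (Fin 2) ℂ, τ * τ' = 1 ∧ τ' * τ = 1 ∧
      ∀ x y : ℂ, u * (τ 0 0 * x + τ 0 1 * y) + v * (τ 1 0 * x + τ 1 1 * y) = y := by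
  by_cases hu : u = 0
  · have hv : v ≠ 0 := h.resolve_left (not_not.mpr hu)
    refine ⟨!![v, 0; 0, v⁻¹], !![v⁻¹, 0; 0, v], ?_, ?_, ?_⟩
    · ext i j
      fin_cases i <;> fin_cases j <;> simp [Matrix.mul_apply, Fin.sum_univ_two, hv]
    · ext i j
      fin_cases i <;> fin_cases j <;> simp [Matrix.mul_apply, Fin.sum_univ_two, hv]
    · intro x y
      simp [hu, hv]
  · refine ⟨!![v, u⁻¹; -u, 0], !![0, -u⁻¹; u, v], ?_, ?_, ?_⟩
    · ext i j
      fin_cases i <;> fin_cases j <;> simp [Matrix.mul_apply, Fin.sum_univ_two, hu, mul_comm]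
    · ext i j
      fin_cases i <;> fin_cases j <;> simp [Matrix.mul_apply, Fin.sum_univ_two, hu, mul_comm]
    · intro x y
      simp only [Matrix.of_apply, Matrix.cons_val', Matrix.cons_val_zero, Matrix.cons_val_one,
        Matrix.empty_val', Matrix.cons_val_fin_one]
      field_simp
      ring

/-! ### Transport along the elementary moves -/

/-- The normal form: if `c 0 = Y²` and `c 1 = X²`, take identity matrices. -/
theorem good_base (c : Fin 3 → Fin 3 → ℂ) (h0 : c 0 = ![0, 0, 1]) (h1 : c 1 = ![1, 0, 0]) :
    GOOD[c] :=
  ⟨1, 1, 1, 1, by simp, by simp, by simp, by simp, fun x y => by simp [Matrix.one_apply, h0],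
    fun x y => by simp [Matrix.one_apply, h1]⟩

/-- Base-point-freeness is invariant under permuting the forms. -/
theorem bpf_perm (c : Fin 3 → Fin 3 → ℂ) (π : Equiv.Perm (Fin 3)) (h : BPF[c]) (x y : ℂ)
    (hxy : ∀ a, EV[c (π a), x, y] = 0) : x = 0 ∧ y = 0 :=
  h x y fun a => by simpa using hxy (π.symm a)

/-- The conclusion descends along a permutation of the forms. -/
theorem good_of_perm (c : Fin 3 → Fin 3 → ℂ) (π : Equiv.Perm (Fin 3))
    (h : GOOD[fun a => c (π a)]) : GOOD[c] := by
  obtain ⟨Λ, Λ', σ, σ', h1, h2, h3, h4, h5, h6⟩ := h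
  refine ⟨Λ.submatrix id π.symm, Λ'.submatrix π.symm id, σ, σ', ?_, ?_, h3, h4, ?_, ?_⟩
  · rw [Matrix.submatrix_mul_equiv, h1, Matrix.submatrix_id_id]
  · rw [← Matrix.submatrix_mul Λ' Λ _ id _ Function.bijective_id, h2, Matrix.submatrix_one_equiv]
  · exact fun x y => by rw [← h5 x y]; exact Fintype.sum_equiv π.symm _ _ fun b => by simp
  · exact fun x y => by rw [← h6 x y]; exact Fintype.sum_equiv π.symm _ _ fun b => by simp

/-- Base-point-freeness passes to an invertible recombination `c' a = Σ_b M a b • c b`. -/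
theorem bpf_comb (c c' : Fin 3 → Fin 3 → ℂ) (M M' : Matrix (Fin 3) (Fin 3) ℂ) (hM' : M' * M = 1)
    (hev : ∀ a x y, EV[c' a, x, y] = ∑ b, M a b * EV[c b, x, y]) (h : BPF[c]) (x y : ℂ)
    (hxy : ∀ a, EV[c' a, x, y] = 0) : x = 0 ∧ y = 0 := by
  have hw : (M.mulVec fun b => EV[c b, x, y]) = fun a => EV[c' a, x, y] := by
    funext a; rw [hev]; rfl
  have hw' : (fun b => EV[c b, x, y]) = M'.mulVec fun a => EV[c' a, x, y] := by
    rw [← hw, Matrix.mulVec_mulVec, hM', Matrix.one_mulVec]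
  refine h x y fun b => ?_
  have hb := congrFun hw' b
  simpa [Matrix.mulVec, dotProduct, hxy] using hb

/-- The conclusion descends along an invertible recombination `c' a = Σ_b M a b • c b`. -/
theorem good_of_comb (c c' : Fin 3 → Fin 3 → ℂ) (M M' : Matrix (Fin 3) (Fin 3) ℂ)
    (hM : M * M' = 1) (hM' : M' * M = 1)
    (hev : ∀ a x y, EV[c' a, x, y] = ∑ b, M a b * EV[c b, x, y]) (h : GOOD[c']) : GOOD[c] := by
  obtain ⟨Λ, Λ', σ, σ', h1, h2, h3, h4, h5, h6⟩ := h
  refine ⟨Λ * M, M' * Λ', σ, σ', ?_, ?_, h3, h4, ?_, ?_⟩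
  · rw [Matrix.mul_assoc, ← Matrix.mul_assoc M, hM, Matrix.one_mul, h1]
  · rw [Matrix.mul_assoc, ← Matrix.mul_assoc Λ', h2, Matrix.one_mul, hM']
  · intro x y
    rw [← h5 x y]; simp only [hev, Matrix.mul_apply, Fin.sum_univ_three]; ring
  · intro x y
    rw [← h6 x y]; simp only [hev, Matrix.mul_apply, Fin.sum_univ_three]; ring

/-- Base-point-freeness passes to the system obtained by an invertible linear substitution. -/
theorem bpf_subst (c c' : Fin 3 → Fin 3 → ℂ) (τ τ' : Matrix (Fin 2) (Fin 2) ℂ) (hτ' : τ' * τ = 1)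
    (hev : ∀ b x y, EV[c' b, x, y] = EV[c b, τ 0 0 * x + τ 0 1 * y, τ 1 0 * x + τ 1 1 * y])
    (h : BPF[c]) (x y : ℂ) (hxy : ∀ a, EV[c' a, x, y] = 0) : x = 0 ∧ y = 0 := by
  obtain ⟨hX, hY⟩ := h (τ 0 0 * x + τ 0 1 * y) (τ 1 0 * x + τ 1 1 * y) fun a => by
    rw [← hev]; exact hxy a
  have ex := mul_subst τ' τ x y 0
  have ey := mul_subst τ' τ x y 1
  rw [hτ'] at ex ey
  simp at ex ey
  exact ⟨by linear_combination -ex + τ' 0 0 * hX + τ' 0 1 * hY,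
    by linear_combination -ey + τ' 1 0 * hX + τ' 1 1 * hY⟩

/-- The conclusion descends along an invertible linear substitution. -/
theorem good_of_subst (c c' : Fin 3 → Fin 3 → ℂ) (τ τ' : Matrix (Fin 2) (Fin 2) ℂ)
    (hτ : τ * τ' = 1) (hτ' : τ' * τ = 1)
    (hev : ∀ b x y, EV[c' b, x, y] = EV[c b, τ 0 0 * x + τ 0 1 * y, τ 1 0 * x + τ 1 1 * y])
    (h : GOOD[c']) : GOOD[c] := by
  obtain ⟨Λ, Λ', σ, σ', h1, h2, h3, h4, h5, h6⟩ := h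
  refine ⟨Λ, Λ', τ * σ, σ' * τ', h1, h2, ?_, ?_, ?_, ?_⟩
  · rw [Matrix.mul_assoc, ← Matrix.mul_assoc σ, h3, Matrix.one_mul, hτ]
  · rw [Matrix.mul_assoc, ← Matrix.mul_assoc τ', hτ', Matrix.one_mul, h4]
  · intro x y
    rw [← h5 x y]; exact Finset.sum_congr rfl fun b _ => by rw [hev, mul_subst, mul_subst]
  · intro x y
    rw [← h6 x y]; exact Finset.sum_congr rfl fun b _ => by rw [hev, mul_subst, mul_subst]

/-! ### The chain of reductions -/

/-- Values of the transposition `(1 2)` of `Fin 3`. -/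
theorem swap12 : Equiv.swap (1 : Fin 3) 2 0 = 0 ∧ Equiv.swap (1 : Fin 3) 2 1 = 2 := by decide

/-- Last step: `c 0 = Y²` and `c 1` has a nonzero `X²`-coefficient. -/
theorem good_at1 (c : Fin 3 → Fin 3 → ℂ) (h0 : c 0 = ![0, 0, 1]) (h1 : c 1 0 ≠ 0) : GOOD[c] := by
  -- the shear `X = x + m y`, `Y = y` and the sheared system `c₂`
  obtain ⟨m, hm⟩ : ∃ m : ℂ, m = -c 1 1 / (2 * c 1 0) := ⟨_, rfl⟩
  obtain ⟨c₂, hc₂⟩ : ∃ c₂ : Fin 3 → Fin 3 → ℂ,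
      ∀ b, c₂ b = ![c b 0, 2 * c b 0 * m + c b 1, c b 0 * m ^ 2 + c b 1 * m + c b 2] :=
    ⟨_, fun _ => rfl⟩
  refine good_of_subst c c₂ !![1, m; 0, 1] !![1, -m; 0, 1] ?_ ?_ (fun b x y => ?_) ?_
  · ext i j
    fin_cases i <;> fin_cases j <;> simp [Matrix.mul_apply, Fin.sum_univ_two]
  · ext i j
    fin_cases i <;> fin_cases j <;> simp [Matrix.mul_apply, Fin.sum_univ_two]
  · simp [hc₂]
    ring
  -- the recombination: form `1 ← (form 1 - κ · form 0) / α`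
  obtain ⟨κ, hκ⟩ : ∃ κ : ℂ, κ = c 1 0 * m ^ 2 + c 1 1 * m + c 1 2 := ⟨_, rfl⟩
  refine good_of_comb c₂ ![![0, 0, 1], ![1, 0, 0], c₂ 2]
    !![1, 0, 0; -κ / c 1 0, (c 1 0)⁻¹, 0; 0, 0, 1] !![1, 0, 0; κ, c 1 0, 0; 0, 0, 1] ?_ ?_ ?_
    (good_base _ rfl rfl)
  · ext i j
    fin_cases i <;> fin_cases j <;> simp [Matrix.mul_apply, Fin.sum_univ_three, h1]
    ring
  · ext i j
    fin_cases i <;> fin_cases j <;> simp [Matrix.mul_apply, Fin.sum_univ_three, h1]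
    field_simp
    ring
  · intro a x y
    fin_cases a
    · simp [Fin.sum_univ_three, hc₂, h0]
    · subst hκ hm
      simp [Fin.sum_univ_three, hc₂, h0]
      field_simp
      ring
    · simp [Fin.sum_univ_three]

/-- `c 0 = Y²` and no common nontrivial zero: another form has a nonzero `X²`-coefficient. -/
theorem good_at0 (c : Fin 3 → Fin 3 → ℂ) (hB : BPF[c]) (h0 : c 0 = ![0, 0, 1]) : GOOD[c] := by
  obtain ⟨a, ha⟩ : ∃ a, c a 0 ≠ 0 := by
    by_contra! hc
    have h10 := hB 1 0 fun a => by simp [hc a]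
    simp at h10
  have ha0 : a ≠ 0 := by rintro rfl; simp [h0] at ha
  have key : ∀ a : Fin 3, a ≠ 0 → a = 1 ∨ a = 2 := by decide
  obtain rfl | rfl := key a ha0
  · exact good_at1 c h0 ha
  · exact good_of_perm c (Equiv.swap 1 2) (good_at1 (fun a => c (Equiv.swap 1 2 a))
      (by simp only [swap12]; exact h0) (by simp only [swap12]; exact ha))

/-- No common nontrivial zero and `Y² = Σ_b s_b c_b` with `s 0 ≠ 0`. -/
theorem good_of_ysq0 (c : Fin 3 → Fin 3 → ℂ) (hB : BPF[c]) (s : Fin 3 → ℂ)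
    (hs : ∀ x y : ℂ, ∑ b, s b * EV[c b, x, y] = y ^ 2) (hs0 : s 0 ≠ 0) : GOOD[c] := by
  -- the recombination: form `0 ← Σ_b s_b c_b`
  have hev : ∀ a x y, EV[![![0, 0, 1], c 1, c 2] a, x, y] =
      ∑ b, !![s 0, s 1, s 2; 0, 1, 0; 0, 0, 1] a b * EV[c b, x, y] := by
    intro a x y
    fin_cases a
    · trans ∑ b, s b * EV[c b, x, y]
      · rw [hs]
        simp
      · exact Finset.sum_congr rfl fun b _ => by fin_cases b <;> rfl
    · simp [Fin.sum_univ_three]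
    · simp [Fin.sum_univ_three]
  have hEE' : !![s 0, s 1, s 2; 0, 1, 0; 0, 0, 1] *
      !![(s 0)⁻¹, -s 1 / s 0, -s 2 / s 0; 0, 1, 0; 0, 0, 1] = (1 : Matrix (Fin 3) (Fin 3) ℂ) := by
    ext i j
    fin_cases i <;> fin_cases j <;> simp [Matrix.mul_apply, Fin.sum_univ_three, hs0] <;>
      field_simp <;> ring
  have hE'E : !![(s 0)⁻¹, -s 1 / s 0, -s 2 / s 0; 0, 1, 0; 0, 0, 1] *
      !![s 0, s 1, s 2; 0, 1, 0; 0, 0, 1] = (1 : Matrix (Fin 3) (Fin 3) ℂ) := by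
    ext i j
    fin_cases i <;> fin_cases j <;> simp [Matrix.mul_apply, Fin.sum_univ_three, hs0] <;> ring
  exact good_of_comb c ![![0, 0, 1], c 1, c 2] _ _ hEE' hE'E hev
    (good_at0 _ (bpf_comb c ![![0, 0, 1], c 1, c 2] _ _ hE'E hev hB) rfl)

/-- No common nontrivial zero and `Y²` in the span of the forms. -/
theorem good_of_ysq (c : Fin 3 → Fin 3 → ℂ) (hB : BPF[c]) (s : Fin 3 → ℂ)
    (hs : ∀ x y : ℂ, ∑ b, s b * EV[c b, x, y] = y ^ 2) : GOOD[c] := by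
  obtain ⟨k, hk⟩ : ∃ k, s k ≠ 0 := by
    by_contra! h
    have h01 := hs 0 1
    simp [h] at h01
  refine good_of_perm c (Equiv.swap 0 k) (good_of_ysq0 (fun a => c (Equiv.swap 0 k a))
    (bpf_perm c _ hB) (fun b => s (Equiv.swap 0 k b)) ?_ (by simpa using hk))
  exact fun x y => (Equiv.sum_comp (Equiv.swap 0 k) (fun b => s b * EV[c b, x, y])).trans (hs x y)

/-- No common nontrivial zero, `c 0` has a nonzero `X²`-coefficient, and a zero `(X₀, Y₀)` of
`c 0` is not a zero of `c 1`: the pencil `s c 0 + t c 1` contains a nonzero square. -/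
theorem good_x01 (c : Fin 3 → Fin 3 → ℂ) (hB : BPF[c]) (h00 : c 0 0 ≠ 0) (X₀ Y₀ : ℂ)
    (hz0 : EV[c 0, X₀, Y₀] = 0) (hz1 : EV[c 1, X₀, Y₀] ≠ 0) : GOOD[c] := by
  -- a nontrivial zero of the discriminant of the pencil
  obtain ⟨s₀, t₀, hst, hD⟩ := exists_zero (c 0 1 ^ 2 - 4 * c 0 0 * c 0 2)
    (2 * c 0 1 * c 1 1 - 4 * c 0 0 * c 1 2 - 4 * c 1 0 * c 0 2) (c 1 1 ^ 2 - 4 * c 1 0 * c 1 2)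
  -- the member `s₀ c 0 + t₀ c 1` is a square `(u X + v Y)²`
  obtain ⟨u, v, hu, huv, hv⟩ := exists_sq (s₀ * c 0 0 + t₀ * c 1 0) (s₀ * c 0 1 + t₀ * c 1 1)
    (s₀ * c 0 2 + t₀ * c 1 2) (by linear_combination hD)
  have hsq : ∀ x y : ℂ, ∑ b, ![s₀, t₀, 0] b * EV[c b, x, y] = (u * x + v * y) ^ 2 := by
    intro x y
    simp only [Fin.sum_univ_three, Matrix.cons_val_zero, Matrix.cons_val_one,
      Matrix.cons_val_two, Matrix.head_cons, Matrix.tail_cons]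
    linear_combination x ^ 2 * hu + x * y * huv + y ^ 2 * hv
  -- and it is nonzero
  have hne : u ≠ 0 ∨ v ≠ 0 := by
    by_contra! h
    obtain ⟨rfl, rfl⟩ := h
    have h3 := hsq X₀ Y₀
    simp only [Fin.sum_univ_three, Matrix.cons_val_zero, Matrix.cons_val_one,
      Matrix.cons_val_two, Matrix.head_cons, Matrix.tail_cons] at h3
    have ht : t₀ = 0 :=
      (mul_eq_zero.mp (by linear_combination h3 - s₀ * hz0)).resolve_right hz1
    rw [ht] at hu
    have hs : s₀ = 0 := (mul_eq_zero.mp (by linear_combination hu)).resolve_right h00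
    exact hst.elim (fun h => h hs) (fun h => h ht)
  -- adapted coordinates and the substituted system `c'`
  obtain ⟨τ, τ', hτ, hτ', hyτ⟩ := exists_adapted u v hne
  obtain ⟨c', hc'⟩ : ∃ c' : Fin 3 → Fin 3 → ℂ, ∀ b, c' b =
      ![c b 0 * τ 0 0 ^ 2 + c b 1 * τ 0 0 * τ 1 0 + c b 2 * τ 1 0 ^ 2,
        2 * c b 0 * τ 0 0 * τ 0 1 + c b 1 * (τ 0 0 * τ 1 1 + τ 0 1 * τ 1 0) +
          2 * c b 2 * τ 1 0 * τ 1 1,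
        c b 0 * τ 0 1 ^ 2 + c b 1 * τ 0 1 * τ 1 1 + c b 2 * τ 1 1 ^ 2] := ⟨_, fun _ => rfl⟩
  have hev : ∀ b x y, EV[c' b, x, y] = EV[c b, τ 0 0 * x + τ 0 1 * y, τ 1 0 * x + τ 1 1 * y] := by
    intro b x y
    simp only [hc', Matrix.cons_val_zero, Matrix.cons_val_one, Matrix.cons_val_two,
      Matrix.head_cons, Matrix.tail_cons]
    ring
  refine good_of_subst c c' τ τ' hτ hτ' hev
    (good_of_ysq c' (bpf_subst c c' τ τ' hτ' hev hB) ![s₀, t₀, 0] fun x y => ?_)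
  simp_rw [hev]
  rw [hsq, hyτ]

/-- No common nontrivial zero and `c 0` has a nonzero `X²`-coefficient. -/
theorem good_x0 (c : Fin 3 → Fin 3 → ℂ) (hB : BPF[c]) (h00 : c 0 0 ≠ 0) : GOOD[c] := by
  obtain ⟨X₀, Y₀, hXY, hz0⟩ := exists_zero (c 0 0) (c 0 1) (c 0 2)
  obtain ⟨a, ha⟩ : ∃ a, EV[c a, X₀, Y₀] ≠ 0 := by
    by_contra! h
    obtain ⟨rfl, rfl⟩ := hB X₀ Y₀ h
    simp at hXY
  have ha0 : a ≠ 0 := by rintro rfl; exact ha hz0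
  have key : ∀ a : Fin 3, a ≠ 0 → a = 1 ∨ a = 2 := by decide
  obtain rfl | rfl := key a ha0
  · exact good_x01 c hB h00 X₀ Y₀ hz0 ha
  · exact good_of_perm c (Equiv.swap 1 2) (good_x01 (fun a => c (Equiv.swap 1 2 a))
      (bpf_perm c _ hB) (by simp only [swap12]; exact h00) X₀ Y₀
      (by simp only [swap12]; exact hz0) (by simp only [swap12]; exact ha))

/-- The main reduction: no common nontrivial zero implies the conclusion. -/
theorem good_of_bpf (c : Fin 3 → Fin 3 → ℂ) (hB : BPF[c]) : GOOD[c] := by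
  obtain ⟨a, ha⟩ : ∃ a, c a 0 ≠ 0 := by
    by_contra! hc
    have h10 := hB 1 0 fun a => by simp [hc a]
    simp at h10
  exact good_of_perm c (Equiv.swap 0 a)
    (good_x0 (fun b => c (Equiv.swap 0 a b)) (bpf_perm c _ hB) (by simpa using ha))

end CorankTwoSquares

/-- **Piece A of `stub_nondegenerateCorankTwo`** (crux stmt-ValiantsHypothesis-7392, line
`registered`, skeleton v6): three binary quadratic forms over `ℂ` with no common nontrivial zero
admit an invertible `3 × 3` recombination `Λ` and an invertible `2 × 2` change of variables `σ`
after which form `0` is `y²` and form `1` is `x²` (a base-point-free net of binary quadratics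
contains two independent squares). -/
theorem binaryQuadratic_squares :
    ∀ (c : Fin 3 → Fin 3 → ℂ),
      (∀ x y : ℂ, (∀ a, c a 0 * x ^ 2 + c a 1 * x * y + c a 2 * y ^ 2 = 0) → x = 0 ∧ y = 0) →
      ∃ (Λ Λ' : Matrix (Fin 3) (Fin 3) ℂ) (σ σ' : Matrix (Fin 2) (Fin 2) ℂ),
        Λ * Λ' = 1 ∧ Λ' * Λ = 1 ∧ σ * σ' = 1 ∧ σ' * σ = 1 ∧
        (∀ x y : ℂ, ∑ b, Λ 0 b * (c b 0 * (σ 0 0 * x + σ 0 1 * y) ^ 2 +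
            c b 1 * (σ 0 0 * x + σ 0 1 * y) * (σ 1 0 * x + σ 1 1 * y) + c b 2 * (σ 1 0 * x + σ 1 1 * y) ^ 2) = y ^ 2) ∧
        (∀ x y : ℂ, ∑ b, Λ 1 b * (c b 0 * (σ 0 0 * x + σ 0 1 * y) ^ 2 +
            c b 1 * (σ 0 0 * x + σ 0 1 * y) * (σ 1 0 * x + σ 1 1 * y) + c b 2 * (σ 1 0 * x + σ 1 1 * y) ^ 2) = x ^ 2) :=
  fun c hc => CorankTwoSquares.good_of_bpf c hc

end Summit.ValiantsHypothesis.ValiantsHypothesis.Theorems.BinomialCandidateStubs
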